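import Summits.QuantumFields.BalabanUV.Beta.SpineRecursiveT2All
import Summits.QuantumFields.BalabanUV.Beta.SecondOrderSplitLiteral
import Summits.QuantumFields.BalabanUV.Beta.SpineRecursiveT2AllCanon

-- `BalabanUV.Beta.GAN24.CombQuarticTableLawTwinsA`: W-an2-1 twin chain, links CombQuarticTableLawClosed, CombQuarticTableLawCanon (one module per ≤ 400-line group; each link keeps its own module docstring, section and namespace).

/-!
# `BalabanUV.Beta.GAN24.CombQuarticTableLawClosed` — binder row G-an2-4 ∕ (CONV-C), W-slot, row (C) at levels ≥ 1, WANTED W-an2-1 (the quartic TABLE-level reflection law of the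
# comb tower at the literal), FIRST TWIN OF an2's END CHAIN: **THE TABLE LAW ⟸ THE LETTERS, THE LETTER CLASSES AND THE LOCK ONLY** — an2's
# `SpineRecursiveT2All.T2RecAt_bref_all_of_letters` (gen 18) with its four mechanical binders (hsplit), (hDg), (hX2L), (hΔL) DISCHARGED by the D1 swarm's literal lemmas
# exactly as an2's KERNEL END `SpineRecursiveT2AllClosed.…_of_letters_closed` does — but concluding the TABLE law (the hypothesis `hlaw` of MY
# `CombChargeParityOddOfQuarticLaw`), not the kernel covariance (road-P2 chair of row G-an2-4, unit `b2b-balaban-gan24-p2` gen 48, crux team (2))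

NOT IN PRINT; OUR BOOKKEEPING ([folklore] wiring BY NAME, a twin of an2 gen 18's `…_of_letters_closed` with the root call swapped; 0 `def`, 0 cited facts, 0 `def … : Prop`, 0 sorry).
HONEST FRAMING (cell contract, verbatim): «discharging `BetaPertH` makes Bałaban's UV stability UNCONDITIONAL — a real constructive-QFT result; it is NOT the continuum limit and
NOT the Clay problem.»  HONEST DEPENDENCY (verbatim): «continuum YM on T⁴ ⇐ BetaPertH ∧ nine spine estimates (0/9 proved); BetaPertH ⇐ (D1) ∧ (D4) ∧ CAP+tail; G-an2-4 gates
asym, D1 and NE2/3/4.»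

WHAT.  **`T2RecAt_bref_all_of_letters_closed`** (`d + 1 = 4`, odd `Lc`, centred root, pin `(cE, cVH) = (Lc⁴, −Lc⁸∕2)`): for every level `j`, axis `α` and bond pair,
`T2RecAt … j κ (bref α κ u) κ′ (bref α κ′ u′) = (ε_κ ε_κ′) • refK (Φ Lc α) (T2RecAt … j κ u κ′ u′ + conjW 𝕄_j (S_j κ u) (S_j κ′ u′) (diagK (γ_j·ctGen α κ u)) (diagK (γ_j·ctGen α κ′ u′))
(diagK (h j α κ u κ′ u′)) + R2 j α κ u κ′ u′)` from EXACTLY an2's letters (h0) (hM2) (hBfm∕hBmf∕hBmm)+(hRBff)+(hB0), the letter classes (`h` bounded with `diagK ∘ h` `LocStencil₂`,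
`R2 j α` and `RM j α` localised), the displayed data definitions (hX2s)∕(hΔ) and the remainder recursion (hR2succ), and the lock (hlock2) — the binders of `…_of_letters_closed`
VERBATIM minus the four the kernel step alone consumed ((hBt), (hmixt), the parities of `R2`∕`RM`).  EVERY LETTER IS A HYPOTHESIS here; the successor twins (`…Canon`, `…Final`,
`…AntiTwin`, `…Wilson`, `…Sockets`, `…LetterLevels`, `…TableLawEnd`, `…JsRowD1Pin`) discharge them down to the literal exactly as an2's kernel ENDs do.  Discharges NOTHING of
(C)_{≥1} ∕ (Q-L) ∕ (H1♮); (β) of record untouched; NEVER «G-an2-4 closed» as (CONV-C); NOT D1, NOT `BetaPertH`, NOT continuum, NOT Clay.  2026-08-23; no existing file touched.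
-/

noncomputable section

open Finset
open scoped BigOperators
open Literature.MathematicalPhysics.QuantumFieldTheory
open Literature.MathematicalPhysics.QuantumFieldTheory.Balaban1983to89
open Literature.MathematicalPhysics.QuantumFieldTheory.Balaban1983to89.Beta
open ExpKernelCalculus (MKer Decays BiLoc comp tadpole VertexFamily VertexFamily₂ shiftK)
open AffineAveraging (box toSite)
open AveragingContoursRooted (ctr ctrOff ctrOff_mem_box)
open PolarizationSign (reflSign AxisReflectionCovariant)
open KernelReflection (refK refK_apply)
open ResolventReflection (bref Φ)
open OneStepResolventKernel (Fib LocStencil JetData wsum)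
open OneStepKernelFamily (KInvStep colH vertexOfK TbalOf flipK)
open BalabanStepJetsSucc (wE wVH mmRead)
open BalabanCompositeJets (LocStencil₂)
open BalabanStepW2 (M2Of wV4 wB2)
open SecondOrderResponse (dM W2OfK W2SymOfK LocStencilFM vertex2OfK mixOfK K2OfK)
open Summit.QuantumFields.BalabanUV.Beta.ChartConjugation (conjV conjW)
open Summit.QuantumFields.BalabanUV.Beta.AxialDressingRooted (coDressKBmAt)
open Summit.QuantumFields.BalabanUV.Beta.BorderedHessian (diagK ctGen bhKStepAt stepScale sgnK)
open Summit.QuantumFields.BalabanUV.Beta.WardLocusCubic (mmSym)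
open Summit.QuantumFields.BalabanUV.Beta.SecondOrderSplitLiteral (W2OfK_sharp_split_literal₂ loc_dM_sharp_literal loc_diagK_secondSymbol_literal loc_Delta_literal₂)


namespace Summit.QuantumFields.BalabanUV.Beta.GAN24.CombQuarticTableLawClosed

open Summit.QuantumFields.BalabanUV.Beta.TameKernelCalculus
open Summit.QuantumFields.BalabanUV.Beta.SpineRooted

variable {Lc : ℕ} [NeZero Lc]

/-- NOT IN PRINT; OUR BOOKKEEPING.  **THE QUARTIC TABLE LAW ⟸ THE LETTERS, THE LETTER CLASSES AND THE LOCK ONLY** (see the module docstring). -/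
theorem T2RecAt_bref_all_of_letters_closed (hLc : Odd Lc) (cΛ cE₂ cB : ℝ) (T : Fin 4 → Fin 4 → Fin 4 → Fin 4 → ℝ)
    {vh₂S : Fin 4 → (Fin 4 → ℤ) → Fin 4 → (Fin 4 → ℤ) → MKer 4 (Fib 3)} (hB : ∃ C δ : ℝ, 0 < δ ∧ LocStencil₂ vh₂S C δ)
    (hB0 : ∀ κ u κ' u' (x z : Fin 4 → ℤ) (β β' : Fin 4), vh₂S κ u κ' u' x z (Sum.inl β) (Sum.inl β') = 0)
    {mixFF : Fin 4 → (Fin 4 → ℤ) → Fin 4 → (Fin 4 → ℤ) → MKer 4 (Fib 3)} (hmix : ∃ C δ : ℝ, 0 < δ ∧ LocStencilFM Lc mixFF C δ)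
    (γ : ℕ → ℝ) (hγ : ∀ j, γ j = -((Lc : ℝ) ^ 8 / 2) * wVH 3 Lc j / (stepScale 3 Lc j * (Lc : ℝ) ^ 4))
    (hlock2 : ∀ j, cE₂ * wV4 3 Lc (j + 1) * wVH 3 Lc (j + 1) = ((Lc : ℝ) ^ 4 * wE 3 Lc (j + 1)) ^ 2)
    (h : ℕ → Fin 4 → Fin 4 → (Fin 4 → ℤ) → Fin 4 → (Fin 4 → ℤ) → (Fin 4 → ℤ) → Fib 3 → ℝ)
    (R2 : ℕ → Fin 4 → Fin 4 → (Fin 4 → ℤ) → Fin 4 → (Fin 4 → ℤ) → MKer 4 (Fib 3))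
    (RM : ℕ → Fin 4 → Fin 4 → (Fin 4 → ℤ) → Fin 4 → (Fin 4 → ℤ) → MKer 4 (Fib 3))
    (h0 : ∀ (α κ : Fin 4) (u : Fin 4 → ℤ) (κ' : Fin 4) (u' : Fin 4 → ℤ),
      T2RecAt 3 Lc (toSite (ctrOff 4 Lc)) ((Lc : ℝ) ^ 4) (-((Lc : ℝ) ^ 8 / 2)) cΛ cE₂ cB T vh₂S mixFF 0 κ (bref α κ u) κ' (bref α κ' u') =
        (reflSign α κ * reflSign α κ') • refK (Φ Lc α)
          (T2RecAt 3 Lc (toSite (ctrOff 4 Lc)) ((Lc : ℝ) ^ 4) (-((Lc : ℝ) ^ 8 / 2)) cΛ cE₂ cB T vh₂S mixFF 0 κ u κ' u' +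
            conjW (bhKStepAt 3 (toSite (ctrOff 4 Lc)) Lc 0)
              (SpureRecAt 3 Lc (toSite (ctrOff 4 Lc)) ((Lc : ℝ) ^ 4) (-((Lc : ℝ) ^ 8 / 2)) cΛ 0 κ u)
              (SpureRecAt 3 Lc (toSite (ctrOff 4 Lc)) ((Lc : ℝ) ^ 4) (-((Lc : ℝ) ^ 8 / 2)) cΛ 0 κ' u')
              (diagK fun p c => γ 0 * ctGen 3 α Lc κ u p c) (diagK fun p c => γ 0 * ctGen 3 α Lc κ' u' p c) (diagK (h 0 α κ u κ' u')) +
            R2 0 α κ u κ' u'))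
    (hM2 : ∀ (j : ℕ) (α κ : Fin 4) (u : Fin 4 → ℤ) (ρ : Fin 4) (w : Fin 4 → ℤ),
      M2Of 3 Lc mixFF j κ (bref α κ u) ρ (bref α ρ w) =
        (reflSign α κ * reflSign α ρ) • refK (Φ Lc α)
          (M2Of 3 Lc mixFF j κ u ρ w + conjV (M1At 3 Lc (toSite (ctrOff 4 Lc)) cΛ j ρ w) (diagK fun p c => γ j * ctGen 3 α Lc κ u p c) +
            RM j α κ u ρ w))
    (X2s : ℕ → Fin 4 → Fin 4 → (Fin 4 → ℤ) → Fin 4 → (Fin 4 → ℤ) → (Fin 4 → ℤ) → Fib 3 → ℝ)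
    (Δ : ℕ → Fin 4 → Fin 4 → (Fin 4 → ℤ) → Fin 4 → (Fin 4 → ℤ) → MKer 4 (Fib 3))
    (hX2s : X2s = fun j α μ y ν y' p c =>
            (∑ κ, ∑' u, colH (coDressKBmAt (toSite (ctrOff 4 Lc)) Lc (KInvStep (d := 3) Lc j)) Lc μ y κ u *
                ∑ κ', ∑' u', colH (coDressKBmAt (toSite (ctrOff 4 Lc)) Lc (KInvStep (d := 3) Lc j)) Lc ν y' κ' u' * h j α κ u κ' u' p c) +
              ∑ κ, ∑' u, colH (K2OfK (coDressKBmAt (toSite (ctrOff 4 Lc)) Lc (KInvStep (d := 3) Lc j)) Lc (SpureRecAt 3 Lc (toSite (ctrOff 4 Lc)) ((Lc : ℝ) ^ 4) (-((Lc : ℝ) ^ 8 / 2)) cΛ j)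
                  (M1At 3 Lc (toSite (ctrOff 4 Lc)) cΛ j) ν y' +
                (-(comp (comp (coDressKBmAt (toSite (ctrOff 4 Lc)) Lc (KInvStep (d := 3) Lc j))
              (conjV (bhKStepAt 3 (toSite (ctrOff 4 Lc)) Lc j)
                (diagK fun p c => ∑ κ, ∑' u, colH (coDressKBmAt (toSite (ctrOff 4 Lc)) Lc (KInvStep (d := 3) Lc j)) Lc ν y' κ u * (γ j * ctGen 3 α Lc κ u p c))))
              (coDressKBmAt (toSite (ctrOff 4 Lc)) Lc (KInvStep (d := 3) Lc j))))) Lc μ y κ u * (γ j * ctGen 3 α Lc κ u p c))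
    (hΔ : Δ = fun j α μ y ν y' =>
        (dM (-(comp (comp (coDressKBmAt (toSite (ctrOff 4 Lc)) Lc (KInvStep (d := 3) Lc j))
              (conjV (bhKStepAt 3 (toSite (ctrOff 4 Lc)) Lc j)
                (diagK fun p c => ∑ κ, ∑' u, colH (coDressKBmAt (toSite (ctrOff 4 Lc)) Lc (KInvStep (d := 3) Lc j)) Lc ν y' κ u * (γ j * ctGen 3 α Lc κ u p c))))
              (coDressKBmAt (toSite (ctrOff 4 Lc)) Lc (KInvStep (d := 3) Lc j))))
            Lc (SpureRecAt 3 Lc (toSite (ctrOff 4 Lc)) ((Lc : ℝ) ^ 4) (-((Lc : ℝ) ^ 8 / 2)) cΛ j) (M1At 3 Lc (toSite (ctrOff 4 Lc)) cΛ j) μ y +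
          (vertex2OfK (coDressKBmAt (toSite (ctrOff 4 Lc)) Lc (KInvStep (d := 3) Lc j)) Lc (R2 j α) μ y ν y' +
            (mixOfK (coDressKBmAt (toSite (ctrOff 4 Lc)) Lc (KInvStep (d := 3) Lc j)) Lc (RM j α) μ y ν y' + mixOfK (coDressKBmAt (toSite (ctrOff 4 Lc)) Lc (KInvStep (d := 3) Lc j)) Lc (RM j α) ν y' μ y))))
    (hhb : ∀ (j : ℕ) (α : Fin 4), ∃ Bh : ℝ, ∀ κ u κ' u' p c, |h j α κ u κ' u' p c| ≤ Bh)
    (hhl : ∀ (j : ℕ) (α : Fin 4), ∃ Ch mh : ℝ, 0 < mh ∧ LocStencil₂ (fun κ u κ' u' => diagK (h j α κ u κ' u')) Ch mh)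
    (hR2c : ∀ (j : ℕ) (α : Fin 4), ∃ C δ : ℝ, 0 < δ ∧ LocStencil₂ (R2 j α) C δ)
    (hRMc : ∀ (j : ℕ) (α : Fin 4), ∃ C δ : ℝ, 0 < δ ∧ LocStencilFM Lc (RM j α) C δ)
    (RB : ℕ → Fin 4 → Fin 4 → (Fin 4 → ℤ) → Fin 4 → (Fin 4 → ℤ) → MKer 4 (Fib 3))
    (hRBff : ∀ j α κ u κ' u' (x z : Fin 4 → ℤ) (β β' : Fin 4), RB j α κ u κ' u' x z (Sum.inl β) (Sum.inl β') = 0)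
    (hBfm : ∀ (j : ℕ) (α : Fin 4) κ u κ' u' (x z : Fin 4 → ℤ) (β m : Fin 4),
      ((cB * wB2 3 Lc (j + 1)) • vh₂S κ (bref α κ u) κ' (bref α κ' u')) x z (Sum.inl β) (Sum.inr m) =
        ((reflSign α κ * reflSign α κ') • refK (Φ Lc α) ((cB * wB2 3 Lc (j + 1)) • vh₂S κ u κ' u' +
          conjW (bhKStepAt 3 (toSite (ctrOff 4 Lc)) Lc (j + 1))
            (SpureRecAt 3 Lc (toSite (ctrOff 4 Lc)) ((Lc : ℝ) ^ 4) (-((Lc : ℝ) ^ 8 / 2)) cΛ (j + 1) κ u)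
            (SpureRecAt 3 Lc (toSite (ctrOff 4 Lc)) ((Lc : ℝ) ^ 4) (-((Lc : ℝ) ^ 8 / 2)) cΛ (j + 1) κ' u')
            (diagK fun p c => γ (j + 1) * ctGen 3 α Lc κ u p c) (diagK fun p c => γ (j + 1) * ctGen 3 α Lc κ' u' p c) (diagK (h (j + 1) α κ u κ' u')) +
          RB (j + 1) α κ u κ' u')) x z (Sum.inl β) (Sum.inr m))
    (hBmf : ∀ (j : ℕ) (α : Fin 4) κ u κ' u' (x z : Fin 4 → ℤ) (m β : Fin 4),
      ((cB * wB2 3 Lc (j + 1)) • vh₂S κ (bref α κ u) κ' (bref α κ' u')) x z (Sum.inr m) (Sum.inl β) =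
        ((reflSign α κ * reflSign α κ') • refK (Φ Lc α) ((cB * wB2 3 Lc (j + 1)) • vh₂S κ u κ' u' +
          conjW (bhKStepAt 3 (toSite (ctrOff 4 Lc)) Lc (j + 1))
            (SpureRecAt 3 Lc (toSite (ctrOff 4 Lc)) ((Lc : ℝ) ^ 4) (-((Lc : ℝ) ^ 8 / 2)) cΛ (j + 1) κ u)
            (SpureRecAt 3 Lc (toSite (ctrOff 4 Lc)) ((Lc : ℝ) ^ 4) (-((Lc : ℝ) ^ 8 / 2)) cΛ (j + 1) κ' u')
            (diagK fun p c => γ (j + 1) * ctGen 3 α Lc κ u p c) (diagK fun p c => γ (j + 1) * ctGen 3 α Lc κ' u' p c) (diagK (h (j + 1) α κ u κ' u')) +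
          RB (j + 1) α κ u κ' u')) x z (Sum.inr m) (Sum.inl β))
    (hBmm : ∀ (j : ℕ) (α : Fin 4) κ u κ' u' (x z : Fin 4 → ℤ) (m m' : Fin 4),
      ((cB * wB2 3 Lc (j + 1)) • vh₂S κ (bref α κ u) κ' (bref α κ' u')) x z (Sum.inr m) (Sum.inr m') =
        ((reflSign α κ * reflSign α κ') • refK (Φ Lc α) ((cB * wB2 3 Lc (j + 1)) • vh₂S κ u κ' u' +
          conjW (bhKStepAt 3 (toSite (ctrOff 4 Lc)) Lc (j + 1))
            (SpureRecAt 3 Lc (toSite (ctrOff 4 Lc)) ((Lc : ℝ) ^ 4) (-((Lc : ℝ) ^ 8 / 2)) cΛ (j + 1) κ u)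
            (SpureRecAt 3 Lc (toSite (ctrOff 4 Lc)) ((Lc : ℝ) ^ 4) (-((Lc : ℝ) ^ 8 / 2)) cΛ (j + 1) κ' u')
            (diagK fun p c => γ (j + 1) * ctGen 3 α Lc κ u p c) (diagK fun p c => γ (j + 1) * ctGen 3 α Lc κ' u' p c) (diagK (h (j + 1) α κ u κ' u')) +
          RB (j + 1) α κ u κ' u')) x z (Sum.inr m) (Sum.inr m'))
    (hR2succ : ∀ (j : ℕ) (α κ : Fin 4) (u : Fin 4 → ℤ) (κ' : Fin 4) (u' : Fin 4 → ℤ),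
      R2 (j + 1) α κ u κ' u' =
        -((cE₂ * wV4 3 Lc (j + 1)) • mmRead Lc
            (comp (comp (coDressKBmAt (toSite (ctrOff 4 Lc)) Lc (KInvStep (d := 3) Lc j))
              ((1 / 2 : ℝ) • conjV (bhKStepAt 3 (toSite (ctrOff 4 Lc)) Lc j) (diagK fun p a => X2s j α κ' u' κ u p a - X2s j α κ u κ' u' p a) +
                (1 / 2 : ℝ) • (Δ j α κ u κ' u' + Δ j α κ' u' κ u)))
              (coDressKBmAt (toSite (ctrOff 4 Lc)) Lc (KInvStep (d := 3) Lc j)))) +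
          RB (j + 1) α κ u κ' u' +
          conjV (mmRead Lc (coDressKBmAt (toSite (ctrOff 4 Lc)) Lc (KInvStep (d := 3) Lc j)))
            (diagK fun p c => cE₂ * wV4 3 Lc (j + 1) * mmSym Lc (X2s j α κ u κ' u') p c - wVH 3 Lc (j + 1) * h (j + 1) α κ u κ' u' p c))
    :
    ∀ (j : ℕ) (α κ : Fin 4) (u : Fin 4 → ℤ) (κ' : Fin 4) (u' : Fin 4 → ℤ),
      T2RecAt 3 Lc (toSite (ctrOff 4 Lc)) ((Lc : ℝ) ^ 4) (-((Lc : ℝ) ^ 8 / 2)) cΛ cE₂ cB T vh₂S mixFF j κ (bref α κ u) κ' (bref α κ' u') =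
        (reflSign α κ * reflSign α κ') • refK (Φ Lc α)
          (T2RecAt 3 Lc (toSite (ctrOff 4 Lc)) ((Lc : ℝ) ^ 4) (-((Lc : ℝ) ^ 8 / 2)) cΛ cE₂ cB T vh₂S mixFF j κ u κ' u' +
            conjW (bhKStepAt 3 (toSite (ctrOff 4 Lc)) Lc j)
              (SpureRecAt 3 Lc (toSite (ctrOff 4 Lc)) ((Lc : ℝ) ^ 4) (-((Lc : ℝ) ^ 8 / 2)) cΛ j κ u)
              (SpureRecAt 3 Lc (toSite (ctrOff 4 Lc)) ((Lc : ℝ) ^ 4) (-((Lc : ℝ) ^ 8 / 2)) cΛ j κ' u')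
              (diagK fun p c => γ j * ctGen 3 α Lc κ u p c) (diagK fun p c => γ j * ctGen 3 α Lc κ' u' p c) (diagK (h j α κ u κ' u')) +
            R2 j α κ u κ' u') := by

  have hL1 : 1 ≤ Lc := hLc.pos
  have hr := ctrOff_mem_box (d := 4) hL1
  subst hX2s hΔ
  refine T2RecAt_bref_all_of_letters hLc cΛ cE₂ cB T hB hB0 hmix γ hγ hlock2 h R2 RM h0 hM2 _ _
    (fun j α μ y ν y' => ?_) (fun j α ν y' => ?_) (fun j α μ y ν y' => ?_) (fun j α μ y ν y' => ?_) RB hRBff hBfm hBmf hBmm hR2succ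
  · obtain ⟨Bh, hb⟩ := hhb j α
    exact W2OfK_sharp_split_literal₂ hL1 hr _ _ cΛ cE₂ cB T hB hmix γ j α hb (hR2c j α) (hRMc j α) μ y ν y'
  · exact loc_dM_sharp_literal hL1 hr _ _ cΛ γ j α ν y'
  · exact loc_diagK_secondSymbol_literal hL1 hr _ _ cΛ γ j α (hhl j α) μ y ν y'
  · exact loc_Delta_literal₂ hL1 hr _ _ cΛ γ j α (hR2c j α) (hRMc j α) μ y ν y'

end Summit.QuantumFields.BalabanUV.Beta.GAN24.CombQuarticTableLawClosed

end

/-!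
# `BalabanUV.Beta.GAN24.CombQuarticTableLawCanon` — binder row G-an2-4 ∕ (CONV-C), W-slot, row (C) at levels ≥ 1, WANTED W-an2-1, SECOND TWIN OF an2's END CHAIN:
# **THE QUARTIC TABLE LAW WITH THE CANONICAL SECOND SYMBOL ⟸ (hWff) + THE BORDER LETTER ∀ j + (hM2) + THE REMAINDER DATA** — an2 gen 19's
# `SpineRecursiveT2AllCanon.…_of_letters_canon` VERBATIM (level-`0` letter assembled by `SecondOrderZeroCanon.quarticZero_bref_of_ffLaw`, canonical `h`, the level-`0` remainder
# class from `R2 0 = cE₂ • RW + RB 0`) over MY `CombQuarticTableLawClosed.T2RecAt_bref_all_of_letters_closed` instead of the kernel END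
# (road-P2 chair of row G-an2-4, unit `b2b-balaban-gan24-p2` gen 48, crux team (2))

NOT IN PRINT; OUR BOOKKEEPING ([folklore] wiring BY NAME, a twin of an2 gen 19's `…_of_letters_canon` with the root call swapped and the kernel-only binders ((hBt), (hmixt), the
parities of `RW`∕`RB`∕`RM`) dropped; 0 `def`, 0 cited facts, 0 `def … : Prop`, 0 sorry).  HONEST FRAMING (cell contract, verbatim): «discharging `BetaPertH` makes Bałaban's UV
stability UNCONDITIONAL — a real constructive-QFT result; it is NOT the continuum limit and NOT the Clay problem.»  HONEST DEPENDENCY (verbatim): «continuum YM on T⁴ ⇐ BetaPertH ∧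
nine spine estimates (0/9 proved); BetaPertH ⇐ (D1) ∧ (D4) ∧ CAP+tail; G-an2-4 gates asym, D1 and NE2/3/4.»

WHAT.  **`T2RecAt_bref_all_of_letters_canon`**: the conclusion of `T2RecAt_bref_all_of_letters_closed` with `h j α κ u κ′ u′ := γ_j²·ctGen α κ u·ctGen α κ′ u′` (the canonical
second symbol — the shape MY `CombQuarticContactChargeZero` ∕ `CombChargeParityOddOfQuarticLaw` consume with `γ₂ = γ_j²`), from the binders of an2's `…_of_letters_canon` minus the
kernel-only ones; `R2` is still a binder with (hR20)∕(hR2succ) and its classes at levels `j + 1` (the next twin, `…Final`, constructs it and takes the class induction BY NAME).  EVERY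
LETTER IS A HYPOTHESIS; discharges NOTHING of (C)_{≥1} ∕ (Q-L) ∕ (H1♮); (β) of record untouched; NEVER «G-an2-4 closed» as (CONV-C); NOT D1, NOT `BetaPertH`, NOT continuum, NOT
Clay.  2026-08-23; no existing file touched.
-/

noncomputable section

open Finset
open scoped BigOperators
open Literature.MathematicalPhysics.QuantumFieldTheory
open Literature.MathematicalPhysics.QuantumFieldTheory.Balaban1983to89
open Literature.MathematicalPhysics.QuantumFieldTheory.Balaban1983to89.Beta
open ExpKernelCalculus (MKer Decays BiLoc comp tadpole VertexFamily VertexFamily₂ shiftK)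
open AffineAveraging (box toSite)
open AveragingContoursRooted (ctr ctrOff ctrOff_mem_box)
open AveragingHessianKernelsRooted (vhSAt)
open PolarizationSign (reflSign AxisReflectionCovariant)
open KernelReflection (refK refK_apply)
open ResolventReflection (bref Φ)
open OneStepResolventKernel (Fib LocStencil JetData wsum)
open OneStepKernelFamily (KInvStep colH vertexOfK TbalOf flipK)
open StepJetData (wilsonA)
open WilsonBiStencil (wilsonW₂)
open BalabanStepJetsSucc (wE wVH mmRead)
open BalabanCompositeJets (LocStencil₂)
open BalabanStepW2 (M2Of wV4 wB2 locStencil₂_smul' locStencil₂_add')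
open SecondOrderResponse (dM W2OfK W2SymOfK LocStencilFM vertex2OfK mixOfK K2OfK)
open Summit.QuantumFields.BalabanUV.Beta.ChartConjugation (conjV conjW)
open Summit.QuantumFields.BalabanUV.Beta.AxialDressingRooted (coDressKBmAt)
open Summit.QuantumFields.BalabanUV.Beta.BorderedHessian (diagK ctGen bhKStepAt bhKStepAt_zero stepScale sgnK)
open Summit.QuantumFields.BalabanUV.Beta.WardLocusCubic (mmSym)
open Summit.QuantumFields.BalabanUV.Beta.KernelWardLevels (stepScale_zero)
open Summit.QuantumFields.BalabanUV.Beta.KernelWardRemainderParity (parityOdd_add)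
open Summit.QuantumFields.BalabanUV.Beta.SpineRecursiveParity (parityOdd_smul)
open Summit.QuantumFields.BalabanUV.Beta.SecondOrderZeroCanon (quarticZero_bref_of_ffLaw abs_ctGen_mul_ctGen_le locStencil₂_diagK_ctGen_mul_ctGen)



namespace Summit.QuantumFields.BalabanUV.Beta.GAN24.CombQuarticTableLawCanon

open Summit.QuantumFields.BalabanUV.Beta.TameKernelCalculus
open Summit.QuantumFields.BalabanUV.Beta.SpineRooted
open Summit.QuantumFields.BalabanUV.Beta.GAN24.CombQuarticTableLawClosed (T2RecAt_bref_all_of_letters_closed)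

variable {Lc : ℕ} [NeZero Lc]

/-- NOT IN PRINT; OUR BOOKKEEPING.  **THE QUARTIC TABLE LAW, CANONICAL SECOND SYMBOL ⟸ (hWff) + BORDER ∀ j + (hM2) + REMAINDER DATA** (see the module docstring). -/
theorem T2RecAt_bref_all_of_letters_canon (hLc : Odd Lc) (cΛ cE₂ cB : ℝ) (T : Fin 4 → Fin 4 → Fin 4 → Fin 4 → ℝ)
    {vh₂S : Fin 4 → (Fin 4 → ℤ) → Fin 4 → (Fin 4 → ℤ) → MKer 4 (Fib 3)} (hB : ∃ C δ : ℝ, 0 < δ ∧ LocStencil₂ vh₂S C δ)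
    (hB0 : ∀ κ u κ' u' (x z : Fin 4 → ℤ) (β β' : Fin 4), vh₂S κ u κ' u' x z (Sum.inl β) (Sum.inl β') = 0)
    {mixFF : Fin 4 → (Fin 4 → ℤ) → Fin 4 → (Fin 4 → ℤ) → MKer 4 (Fib 3)} (hmix : ∃ C δ : ℝ, 0 < δ ∧ LocStencilFM Lc mixFF C δ)
    (γ : ℕ → ℝ) (hγ : ∀ j, γ j = -((Lc : ℝ) ^ 8 / 2) * wVH 3 Lc j / (stepScale 3 Lc j * (Lc : ℝ) ^ 4))
    (hlock2 : ∀ j, cE₂ * wV4 3 Lc (j + 1) * wVH 3 Lc (j + 1) = ((Lc : ℝ) ^ 4 * wE 3 Lc (j + 1)) ^ 2)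
    (R2 : ℕ → Fin 4 → Fin 4 → (Fin 4 → ℤ) → Fin 4 → (Fin 4 → ℤ) → MKer 4 (Fib 3))
    (RM : ℕ → Fin 4 → Fin 4 → (Fin 4 → ℤ) → Fin 4 → (Fin 4 → ℤ) → MKer 4 (Fib 3))
    (RW : Fin 4 → Fin 4 → (Fin 4 → ℤ) → Fin 4 → (Fin 4 → ℤ) → MKer 4 (Fib 3))
    (RB : ℕ → Fin 4 → Fin 4 → (Fin 4 → ℤ) → Fin 4 → (Fin 4 → ℤ) → MKer 4 (Fib 3))
    -- (hWff) THE WILSON (2,2) LETTER AT LEVEL 0, PARAMETER-FREE UP TO AN ODD FIELD-SUPPORTED SLOT `RW`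
    (hWff : ∀ (α κ : Fin 4) (u : Fin 4 → ℤ) (κ' : Fin 4) (u' : Fin 4 → ℤ) (x z : Fin 4 → ℤ) (β β' : Fin 4),
      wilsonW₂ 3 T κ (bref α κ u) κ' (bref α κ' u') x z (Sum.inl β) (Sum.inl β') =
        ((reflSign α κ * reflSign α κ') • refK (Φ Lc α)
          (wilsonW₂ 3 T κ u κ' u' +
            conjW (bhKStepAt 3 (toSite (ctrOff 4 Lc)) Lc 0) (wilsonA 3 κ u) (wilsonA 3 κ' u')
              (diagK fun p c => (-(1 / 2 : ℝ)) * ctGen 3 α Lc κ u p c) (diagK fun p c => (-(1 / 2 : ℝ)) * ctGen 3 α Lc κ' u' p c)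
              (diagK fun p c => (-(1 / 2 : ℝ)) ^ 2 * (ctGen 3 α Lc κ u p c * ctGen 3 α Lc κ' u' p c)) + RW α κ u κ' u')) x z (Sum.inl β) (Sum.inl β'))
    (hRWl : ∀ α κ u κ' u' (x z : Fin 4 → ℤ) (m : Fin 4) (b' : Fib 3), RW α κ u κ' u' x z (Sum.inr m) b' = 0)
    (hRWr : ∀ α κ u κ' u' (x z : Fin 4 → ℤ) (a' : Fib 3) (m : Fin 4), RW α κ u κ' u' x z a' (Sum.inr m) = 0)
    (hRWc : ∀ α : Fin 4, ∃ C δ : ℝ, 0 < δ ∧ LocStencil₂ (RW α) C δ)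
    -- (hM2) THE MIXED LETTER ∀ j
    (hM2 : ∀ (j : ℕ) (α κ : Fin 4) (u : Fin 4 → ℤ) (ρ : Fin 4) (w : Fin 4 → ℤ),
      M2Of 3 Lc mixFF j κ (bref α κ u) ρ (bref α ρ w) =
        (reflSign α κ * reflSign α ρ) • refK (Φ Lc α)
          (M2Of 3 Lc mixFF j κ u ρ w + conjV (M1At 3 Lc (toSite (ctrOff 4 Lc)) cΛ j ρ w) (diagK fun p c => γ j * ctGen 3 α Lc κ u p c) +
            RM j α κ u ρ w))
    (hRMc : ∀ (j : ℕ) (α : Fin 4), ∃ C δ : ℝ, 0 < δ ∧ LocStencilFM Lc (RM j α) C δ)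
    -- (hB*) THE BORDER LETTER AT EVERY LEVEL j ≥ 0, CANONICAL SECOND SYMBOL
    (hRBff : ∀ j α κ u κ' u' (x z : Fin 4 → ℤ) (β β' : Fin 4), RB j α κ u κ' u' x z (Sum.inl β) (Sum.inl β') = 0)
    (hRBc : ∀ (j : ℕ) (α : Fin 4), ∃ C δ : ℝ, 0 < δ ∧ LocStencil₂ (RB j α) C δ)
    (hBfm : ∀ (j : ℕ) (α : Fin 4) κ u κ' u' (x z : Fin 4 → ℤ) (β m : Fin 4),
      ((cB * wB2 3 Lc j) • vh₂S κ (bref α κ u) κ' (bref α κ' u')) x z (Sum.inl β) (Sum.inr m) =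
        ((reflSign α κ * reflSign α κ') • refK (Φ Lc α) ((cB * wB2 3 Lc j) • vh₂S κ u κ' u' +
          conjW (bhKStepAt 3 (toSite (ctrOff 4 Lc)) Lc j)
            (SpureRecAt 3 Lc (toSite (ctrOff 4 Lc)) ((Lc : ℝ) ^ 4) (-((Lc : ℝ) ^ 8 / 2)) cΛ j κ u)
            (SpureRecAt 3 Lc (toSite (ctrOff 4 Lc)) ((Lc : ℝ) ^ 4) (-((Lc : ℝ) ^ 8 / 2)) cΛ j κ' u')
            (diagK fun p c => γ j * ctGen 3 α Lc κ u p c) (diagK fun p c => γ j * ctGen 3 α Lc κ' u' p c)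
            (diagK fun p c => γ j ^ 2 * (ctGen 3 α Lc κ u p c * ctGen 3 α Lc κ' u' p c)) +
          RB j α κ u κ' u')) x z (Sum.inl β) (Sum.inr m))
    (hBmf : ∀ (j : ℕ) (α : Fin 4) κ u κ' u' (x z : Fin 4 → ℤ) (m β : Fin 4),
      ((cB * wB2 3 Lc j) • vh₂S κ (bref α κ u) κ' (bref α κ' u')) x z (Sum.inr m) (Sum.inl β) =
        ((reflSign α κ * reflSign α κ') • refK (Φ Lc α) ((cB * wB2 3 Lc j) • vh₂S κ u κ' u' +
          conjW (bhKStepAt 3 (toSite (ctrOff 4 Lc)) Lc j)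
            (SpureRecAt 3 Lc (toSite (ctrOff 4 Lc)) ((Lc : ℝ) ^ 4) (-((Lc : ℝ) ^ 8 / 2)) cΛ j κ u)
            (SpureRecAt 3 Lc (toSite (ctrOff 4 Lc)) ((Lc : ℝ) ^ 4) (-((Lc : ℝ) ^ 8 / 2)) cΛ j κ' u')
            (diagK fun p c => γ j * ctGen 3 α Lc κ u p c) (diagK fun p c => γ j * ctGen 3 α Lc κ' u' p c)
            (diagK fun p c => γ j ^ 2 * (ctGen 3 α Lc κ u p c * ctGen 3 α Lc κ' u' p c)) +
          RB j α κ u κ' u')) x z (Sum.inr m) (Sum.inl β))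
    (hBmm : ∀ (j : ℕ) (α : Fin 4) κ u κ' u' (x z : Fin 4 → ℤ) (m m' : Fin 4),
      ((cB * wB2 3 Lc j) • vh₂S κ (bref α κ u) κ' (bref α κ' u')) x z (Sum.inr m) (Sum.inr m') =
        ((reflSign α κ * reflSign α κ') • refK (Φ Lc α) ((cB * wB2 3 Lc j) • vh₂S κ u κ' u' +
          conjW (bhKStepAt 3 (toSite (ctrOff 4 Lc)) Lc j)
            (SpureRecAt 3 Lc (toSite (ctrOff 4 Lc)) ((Lc : ℝ) ^ 4) (-((Lc : ℝ) ^ 8 / 2)) cΛ j κ u)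
            (SpureRecAt 3 Lc (toSite (ctrOff 4 Lc)) ((Lc : ℝ) ^ 4) (-((Lc : ℝ) ^ 8 / 2)) cΛ j κ' u')
            (diagK fun p c => γ j * ctGen 3 α Lc κ u p c) (diagK fun p c => γ j * ctGen 3 α Lc κ' u' p c)
            (diagK fun p c => γ j ^ 2 * (ctGen 3 α Lc κ u p c * ctGen 3 α Lc κ' u' p c)) +
          RB j α κ u κ' u')) x z (Sum.inr m) (Sum.inr m'))
    -- THE DISPLAYED SPLIT SYMBOLS (canonical `h`), THE REMAINDER RECURSION, THE NEXT-LEVEL CLASSES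
    (X2s : ℕ → Fin 4 → Fin 4 → (Fin 4 → ℤ) → Fin 4 → (Fin 4 → ℤ) → (Fin 4 → ℤ) → Fib 3 → ℝ)
    (Δ : ℕ → Fin 4 → Fin 4 → (Fin 4 → ℤ) → Fin 4 → (Fin 4 → ℤ) → MKer 4 (Fib 3))
    (hX2s : X2s = fun j α μ y ν y' p c =>
            (∑ κ, ∑' u, colH (coDressKBmAt (toSite (ctrOff 4 Lc)) Lc (KInvStep (d := 3) Lc j)) Lc μ y κ u *
                ∑ κ', ∑' u', colH (coDressKBmAt (toSite (ctrOff 4 Lc)) Lc (KInvStep (d := 3) Lc j)) Lc ν y' κ' u' *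
                  (γ j ^ 2 * (ctGen 3 α Lc κ u p c * ctGen 3 α Lc κ' u' p c))) +
              ∑ κ, ∑' u, colH (K2OfK (coDressKBmAt (toSite (ctrOff 4 Lc)) Lc (KInvStep (d := 3) Lc j)) Lc (SpureRecAt 3 Lc (toSite (ctrOff 4 Lc)) ((Lc : ℝ) ^ 4) (-((Lc : ℝ) ^ 8 / 2)) cΛ j)
                  (M1At 3 Lc (toSite (ctrOff 4 Lc)) cΛ j) ν y' +
                (-(comp (comp (coDressKBmAt (toSite (ctrOff 4 Lc)) Lc (KInvStep (d := 3) Lc j))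
              (conjV (bhKStepAt 3 (toSite (ctrOff 4 Lc)) Lc j)
                (diagK fun p c => ∑ κ, ∑' u, colH (coDressKBmAt (toSite (ctrOff 4 Lc)) Lc (KInvStep (d := 3) Lc j)) Lc ν y' κ u * (γ j * ctGen 3 α Lc κ u p c))))
              (coDressKBmAt (toSite (ctrOff 4 Lc)) Lc (KInvStep (d := 3) Lc j))))) Lc μ y κ u * (γ j * ctGen 3 α Lc κ u p c))
    (hΔ : Δ = fun j α μ y ν y' =>
        (dM (-(comp (comp (coDressKBmAt (toSite (ctrOff 4 Lc)) Lc (KInvStep (d := 3) Lc j))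
              (conjV (bhKStepAt 3 (toSite (ctrOff 4 Lc)) Lc j)
                (diagK fun p c => ∑ κ, ∑' u, colH (coDressKBmAt (toSite (ctrOff 4 Lc)) Lc (KInvStep (d := 3) Lc j)) Lc ν y' κ u * (γ j * ctGen 3 α Lc κ u p c))))
              (coDressKBmAt (toSite (ctrOff 4 Lc)) Lc (KInvStep (d := 3) Lc j))))
            Lc (SpureRecAt 3 Lc (toSite (ctrOff 4 Lc)) ((Lc : ℝ) ^ 4) (-((Lc : ℝ) ^ 8 / 2)) cΛ j) (M1At 3 Lc (toSite (ctrOff 4 Lc)) cΛ j) μ y +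
          (vertex2OfK (coDressKBmAt (toSite (ctrOff 4 Lc)) Lc (KInvStep (d := 3) Lc j)) Lc (R2 j α) μ y ν y' +
            (mixOfK (coDressKBmAt (toSite (ctrOff 4 Lc)) Lc (KInvStep (d := 3) Lc j)) Lc (RM j α) μ y ν y' + mixOfK (coDressKBmAt (toSite (ctrOff 4 Lc)) Lc (KInvStep (d := 3) Lc j)) Lc (RM j α) ν y' μ y))))
    (hR20 : ∀ (α κ : Fin 4) (u : Fin 4 → ℤ) (κ' : Fin 4) (u' : Fin 4 → ℤ), R2 0 α κ u κ' u' = cE₂ • RW α κ u κ' u' + RB 0 α κ u κ' u')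
    (hR2succ : ∀ (j : ℕ) (α κ : Fin 4) (u : Fin 4 → ℤ) (κ' : Fin 4) (u' : Fin 4 → ℤ),
      R2 (j + 1) α κ u κ' u' =
        -((cE₂ * wV4 3 Lc (j + 1)) • mmRead Lc
            (comp (comp (coDressKBmAt (toSite (ctrOff 4 Lc)) Lc (KInvStep (d := 3) Lc j))
              ((1 / 2 : ℝ) • conjV (bhKStepAt 3 (toSite (ctrOff 4 Lc)) Lc j) (diagK fun p a => X2s j α κ' u' κ u p a - X2s j α κ u κ' u' p a) +
                (1 / 2 : ℝ) • (Δ j α κ u κ' u' + Δ j α κ' u' κ u)))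
              (coDressKBmAt (toSite (ctrOff 4 Lc)) Lc (KInvStep (d := 3) Lc j)))) +
          RB (j + 1) α κ u κ' u' +
          conjV (mmRead Lc (coDressKBmAt (toSite (ctrOff 4 Lc)) Lc (KInvStep (d := 3) Lc j)))
            (diagK fun p c => cE₂ * wV4 3 Lc (j + 1) * mmSym Lc (X2s j α κ u κ' u') p c -
              wVH 3 Lc (j + 1) * (γ (j + 1) ^ 2 * (ctGen 3 α Lc κ u p c * ctGen 3 α Lc κ' u' p c))))
    (hR2c : ∀ (j : ℕ) (α : Fin 4), ∃ C δ : ℝ, 0 < δ ∧ LocStencil₂ (R2 (j + 1) α) C δ)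
    :
    ∀ (j : ℕ) (α κ : Fin 4) (u : Fin 4 → ℤ) (κ' : Fin 4) (u' : Fin 4 → ℤ),
      T2RecAt 3 Lc (toSite (ctrOff 4 Lc)) ((Lc : ℝ) ^ 4) (-((Lc : ℝ) ^ 8 / 2)) cΛ cE₂ cB T vh₂S mixFF j κ (bref α κ u) κ' (bref α κ' u') =
        (reflSign α κ * reflSign α κ') • refK (Φ Lc α)
          (T2RecAt 3 Lc (toSite (ctrOff 4 Lc)) ((Lc : ℝ) ^ 4) (-((Lc : ℝ) ^ 8 / 2)) cΛ cE₂ cB T vh₂S mixFF j κ u κ' u' +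
            conjW (bhKStepAt 3 (toSite (ctrOff 4 Lc)) Lc j)
              (SpureRecAt 3 Lc (toSite (ctrOff 4 Lc)) ((Lc : ℝ) ^ 4) (-((Lc : ℝ) ^ 8 / 2)) cΛ j κ u)
              (SpureRecAt 3 Lc (toSite (ctrOff 4 Lc)) ((Lc : ℝ) ^ 4) (-((Lc : ℝ) ^ 8 / 2)) cΛ j κ' u')
              (diagK fun p c => γ j * ctGen 3 α Lc κ u p c) (diagK fun p c => γ j * ctGen 3 α Lc κ' u' p c) (diagK fun p c => γ j ^ 2 * (ctGen 3 α Lc κ u p c * ctGen 3 α Lc κ' u' p c)) +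
            R2 j α κ u κ' u') := by
  have hL1 : 1 ≤ Lc := hLc.pos
  have hcE₂ : cE₂ = (Lc : ℝ) ^ 8 := (lock2_iff cE₂ 0).1 (hlock2 0)
  -- the level-0 remainder as a family
  have hR20' : ∀ α : Fin 4, R2 0 α = fun κ u κ' u' => cE₂ • RW α κ u κ' u' + RB 0 α κ u κ' u' :=
    fun α => funext fun κ => funext fun u => funext fun κ' => funext fun u' => hR20 α κ u κ' u'
  refine T2RecAt_bref_all_of_letters_closed hLc cΛ cE₂ cB T hB hB0 hmix γ hγ hlock2
    (fun j α κ u κ' u' p c => γ j ^ 2 * (ctGen 3 α Lc κ u p c * ctGen 3 α Lc κ' u' p c)) R2 RM ?_ hM2 X2s Δ hX2s hΔ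
    (fun j α => ⟨_, abs_ctGen_mul_ctGen_le α Lc (γ j ^ 2)⟩)
    (fun j α => ⟨_, 1, one_pos, locStencil₂_diagK_ctGen_mul_ctGen α Lc (γ j ^ 2) zero_le_one⟩)
    ?_ hRMc RB hRBff (fun j => hBfm (j + 1)) (fun j => hBmf (j + 1)) (fun j => hBmm (j + 1)) hR2succ
  · -- (h0) THE LEVEL-0 LETTER, ASSEMBLED from the Wilson law (hWff) and the border letter at level 0
    intro α κ u κ' u'
    have hwB : cB * wB2 3 Lc 0 = cB := by simp [BalabanStepW2.wB2]
    have hγ0 : γ 0 = (Lc : ℝ) ^ 4 * (-(1 / 2 : ℝ)) := by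
      have hL : (Lc : ℝ) ≠ 0 := by exact_mod_cast NeZero.ne Lc
      rw [hγ 0, wVH_zero, stepScale_zero]
      field_simp
    have ha : cE₂ = ((Lc : ℝ) ^ 4) ^ 2 := by rw [hcE₂]; ring
    have hQl : ∀ κ u κ' u' (x z : Fin 4 → ℤ) (m : Fin 4) (b' : Fib 3), wilsonW₂ 3 T κ u κ' u' x z (Sum.inr m) b' = 0 := by
      intro κ u κ' u' x z m b'; rcases b' with b | b <;> rfl
    have hQr : ∀ κ u κ' u' (x z : Fin 4 → ℤ) (a' : Fib 3) (m : Fin 4), wilsonW₂ 3 T κ u κ' u' x z a' (Sum.inr m) = 0 := by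
      intro κ u κ' u' x z a' m; rcases a' with a | a <;> rfl
    have hEl : ∀ κ u (x z : Fin 4 → ℤ) (m : Fin 4) (b' : Fib 3), wilsonA 3 κ u x z (Sum.inr m) b' = 0 := by
      intro κ u x z m b'; rcases b' with b | b <;> rfl
    have hEr : ∀ κ u (x z : Fin 4 → ℤ) (a' : Fib 3) (m : Fin 4), wilsonA 3 κ u x z a' (Sum.inr m) = 0 := by
      intro κ u x z a' m; rcases a' with a | a <;> rfl
    have hVff : ∀ κ u (x z : Fin 4 → ℤ) (β β' : Fin 4),
        ((-((Lc : ℝ) ^ 8 / 2)) • vhSAt (toSite (ctrOff 4 Lc)) 3 Lc rfl κ u) x z (Sum.inl β) (Sum.inl β') = 0 :=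
      fun κ u x z β β' => smul_vhSAt_inl_inl (Lc := Lc) _ _ κ u x z β β'
    have hBfm0 := hBfm 0 α
    have hBmf0 := hBmf 0 α
    have hBmm0 := hBmm 0 α
    simp only [hwB, SpureRecAt_zero_level, bhKStepAt_zero] at hBfm0 hBmf0 hBmm0
    have key := quarticZero_bref_of_ffLaw (d := 3) (L := Lc) (𝕄 := bhKStepAt 3 (toSite (ctrOff 4 Lc)) Lc 0) (a := cE₂) (aE := (Lc : ℝ) ^ 4)
      (b := cB) (κ₁ := -(1 / 2 : ℝ)) (γ' := γ 0) (α := α) (Q := wilsonW₂ 3 T) (R₀ := RW α) (B := vh₂S) (RB := RB 0 α) (E := wilsonA 3)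
      (Vbd := fun κ u => (-((Lc : ℝ) ^ 8 / 2)) • vhSAt (toSite (ctrOff 4 Lc)) 3 Lc rfl κ u)
      hγ0 ha hQl hQr hEl hEr (hRWl α) (hRWr α) hB0 (hRBff 0 α) hVff (hWff α) ?_ ?_ ?_ κ u κ' u'
    · simp only [T2RecAt_zero_level, SpureRecAt_zero_level, hR20]
      exact key
    · simpa only [bhKStepAt_zero] using hBfm0
    · simpa only [bhKStepAt_zero] using hBmf0
    · simpa only [bhKStepAt_zero] using hBmm0
  · -- the `LocStencil₂` class of `R2 j α`: level 0 from (hR20) and the classes of `RW`, `RB 0`; level j+1 given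
    intro j α
    cases j with
    | zero =>
      obtain ⟨C₁, δ₁, hδ₁, h1⟩ := hRWc α
      obtain ⟨C₂, δ₂, hδ₂, h2⟩ := hRBc 0 α
      refine ⟨|cE₂| * C₁ + C₂, min δ₁ δ₂, lt_min hδ₁ hδ₂, ?_⟩
      rw [hR20' α]
      exact locStencil₂_add' (locStencil₂_smul' cE₂ (h1.mono (min_le_left _ _))) (h2.mono (min_le_right _ _))
    | succ j => exact hR2c j α

end Summit.QuantumFields.BalabanUV.Beta.GAN24.CombQuarticTableLawCanon

end
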